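import Summits.Ventures.CertifiedManyBodySolver.Upper.DWaveSourceOpenClusterCut
import Summits.Ventures.CertifiedManyBodySolver.Rows.SourcedTorusRowsBridge
import Literature.MathematicalPhysics.QuantumLattice.FinDimSpectrumProofs
import HarnessLib

/-!
# Cluster trial states for the pinning-field rows, part 4: the product trial state, the cluster
# variational bound for the sourced torus, and the `q`-slot rows

HONEST FRAMING: first certified bounds; not a superconductivity verdict; every number certified or
labelled float. Nothing in this file is a number: it is a soundness edge (trial state ⇒ energy CEILING).

Companion of parts 1–3 (`Upper/TorusRectBlockPartition`, `…NoWrap`, `…DWaveSourceOpenClusterCut`; seat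
hubbard-obs-pin-1). The cluster variational principle (Ruelle 1969 §3.3; tree `HubbardNNNHoppingOpenClusters`
for the particle-number CONSERVING `t–t'` model) for the grand-canonical `d`-wave PAIR-SOURCED torus: the
source breaks particle-number conservation but preserves FERMION PARITY, so a Koszul-signed product
`⊗_R ψ` (`prodFamily` over `rectBlockPartition`) of copies of ONE EVEN cluster vector `ψ` still kills every
inter-block hopping term AND every inter-block source bond (each changes the parity of two different
factors; part 2), while the embedded blocks contribute `⟨ψ, A_C ψ⟩` each:

* `expect_prodFamily_dWaveSourceTorus`: `⟨⊗_R ψ, A_L ⊗_R ψ⟩ = Kx Ky ⟨ψ, A_C ψ⟩` (even unit `ψ`);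
* **`groundEnergy_dWaveSourceTorus_le_mul_expect_openBox`** / `…_le_div_mul_sq`:
  `E₀(dWaveSourceTorus L U μ h) ≤ Kx Ky · Re⟨ψ, dWaveSourceOpenBox a b U μ h ψ⟩ = (Re⟨ψ, A_C ψ⟩/(ab)) · L²`
  (`L = Kx a = Ky b`, `a, b < L`);
* the ROWS: `sourcedTorusEnergyUpperRow_of_clusterState` (one torus), and the uniform
  **`sourcedEnergyUpperRow_of_clusterState`** / `…_of_exists_clusterState`: `Re⟨ψ, A_C ψ⟩ ≤ e·(ab)` for an
  even unit cluster vector (resp. the existential certificate shape) gives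
  `SourcedEnergyUpperRow 0 U μ h q L₀ e` for every `q` with `a ∣ q`, `b ∣ q` and `L₀ > a, b`
  (`4 × 3` clusters: `q = L₀ = 12`) — the input `hcap` of `PinFieldResponseFloorAt.of_energyRows`
  (`Observables/PinningFieldChords.lean`) and of the ceiling chords.

Solver-free; nothing is asserted. A cap alone floors nothing: the FLOOR chord needs, in addition, a
certified sourced energy FLOOR at a smaller field (honesty node `floorSlot_nonpos_of_transported_cap`).
References: D. Ruelle, *Statistical Mechanics: Rigorous Results* (1969) §3.3, Prop. 3.3.2; O. Bratteli,
D. W. Robinson, *Operator Algebras and QSM II* (1997) §5.2.2; T. Koma, H. Tasaki, J. Stat. Phys. 76 (1994)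
745, §1. Tree: parts 1–3, `Rows/SourcedTorusRows[Bridge]`, `groundEnergy_le_rayleigh_holds`.
-/

noncomputable section

namespace Summit.Ventures.CertifiedManyBodySolver

open Matrix Finset Literature.Probability.LatticeModels
open Literature.MathematicalPhysics.QuantumLattice Literature.MathematicalPhysics.QuantumLattice.ThermodynamicLimit
open Literature.MathematicalPhysics.QuantumLattice.TwoCluster Literature.Barriers.HubbardSuperconductivity
open TorusRectBlock ClusterParity
open scoped ComplexOrder

section ProductState

variable {L Kx Ky a b : ℕ} (hLa : L = Kx * a) (hLb : L = Ky * b)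

/-- A bond of the torus that is not the image of a block bond joins two DIFFERENT blocks. [folklore] -/
theorem blockOf_ne_of_not_mem_bonds {bd : Bond (FermionTorus 2 L)}
    (hb : bd ∉ Finset.univ.biUnion fun R : Fin Kx ×ₗ Fin Ky =>
      (Finset.univ : Finset (Bond (Fin a ×ₗ Fin b))).map ⟨bondMap (blockSiteEmb hLa hLb R), bondMap_injective _⟩) :
    blockOf hLa hLb bd.1 ≠ blockOf hLa hLb bd.2.1 := by
  intro heq
  apply hb
  obtain ⟨x, y, σ⟩ := bd
  simp only [Finset.mem_biUnion, Finset.mem_univ, true_and, Finset.mem_map, Function.Embedding.coeFn_mk]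
  refine ⟨blockOf hLa hLb x, (posOf hLa hLb x, posOf hLa hLb y, σ), ?_⟩
  have hy : blockSite hLa hLb (blockOf hLa hLb x) (posOf hLa hLb y) = y := by
    rw [show blockOf hLa hLb x = blockOf hLa hLb y from heq, blockSite_blockOf_posOf]
  simp only [bondMap, blockSiteEmb_apply, blockSite_blockOf_posOf, hy]

/-- A pair of torus sites that is not the image of a block pair lies in two DIFFERENT blocks. [folklore] -/
theorem blockOf_ne_of_not_mem_pairs {z : FermionTorus 2 L × FermionTorus 2 L}
    (hz : z ∉ Finset.univ.biUnion fun R : Fin Kx ×ₗ Fin Ky =>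
      (Finset.univ : Finset ((Fin a ×ₗ Fin b) × (Fin a ×ₗ Fin b))).map
        ⟨Prod.map (blockSiteEmb hLa hLb R) (blockSiteEmb hLa hLb R),
          (blockSiteEmb hLa hLb R).injective.prodMap (blockSiteEmb hLa hLb R).injective⟩) :
    blockOf hLa hLb z.1 ≠ blockOf hLa hLb z.2 := by
  intro heq
  apply hz
  obtain ⟨x, y⟩ := z
  simp only [Finset.mem_biUnion, Finset.mem_univ, true_and, Finset.mem_map, Function.Embedding.coeFn_mk]
  refine ⟨blockOf hLa hLb x, (posOf hLa hLb x, posOf hLa hLb y), ?_⟩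
  have hy : blockSite hLa hLb (blockOf hLa hLb x) (posOf hLa hLb y) = y := by
    rw [show blockOf hLa hLb x = blockOf hLa hLb y from heq, blockSite_blockOf_posOf]
  simp only [Prod.map, blockSiteEmb_apply, blockSite_blockOf_posOf, hy]

variable {ψf : Fin Kx ×ₗ Fin Ky → Fock (Orb (Fin a ×ₗ Fin b))} {p : Fin Kx ×ₗ Fin Ky → ℕ}

/-- An inter-block hopping `c†_{xσ} c_{yτ}` has zero expectation in a product of definite-parity
block vectors. [cite: BratteliRobinsonII1997, §5.2.2 eq. (5.2.13)] -/
theorem star_prodFamily_dotProduct_hop_eq_zero (hψ : ∀ R, HasParity (p R) (ψf R)) {x y : FermionTorus 2 L}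
    (hxy : blockOf hLa hLb x ≠ blockOf hLa hLb y) (σ τ : Fin 2) :
    star ((rectBlockPartition hLa hLb).prodFamily ψf) ⬝ᵥ
      ((creation (orb x σ) * annihilation (orb y τ)) *ᵥ (rectBlockPartition hLa hLb).prodFamily ψf) = 0 := by
  rw [orb_eq_emb hLa hLb x σ, orb_eq_emb hLa hLb y τ]
  exact star_prodFamily_dotProduct_creation_annihilation_eq_zero (rectBlockPartition hLa hLb) hψ hxy _ _

/-- An inter-block bond pair `b_{xy}` has zero expectation in a product of definite-parity block
vectors. [cite: BratteliRobinsonII1997, §5.2.2 eq. (5.2.13)] -/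
theorem star_prodFamily_dotProduct_bondPair_eq_zero (hψ : ∀ R, HasParity (p R) (ψf R)) {x y : FermionTorus 2 L}
    (hxy : blockOf hLa hLb x ≠ blockOf hLa hLb y) :
    star ((rectBlockPartition hLa hLb).prodFamily ψf) ⬝ᵥ
      (bondPair x y *ᵥ (rectBlockPartition hLa hLb).prodFamily ψf) = 0 := by
  rw [bondPair, sub_mulVec, dotProduct_sub, orb_eq_emb hLa hLb x 0, orb_eq_emb hLa hLb y 1,
    orb_eq_emb hLa hLb x 1, orb_eq_emb hLa hLb y 0,
    star_prodFamily_dotProduct_annihilation_annihilation_eq_zero (rectBlockPartition hLa hLb) hψ hxy,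
    star_prodFamily_dotProduct_annihilation_annihilation_eq_zero (rectBlockPartition hLa hLb) hψ hxy, sub_zero]

/-- The adjoint of an inter-block bond pair has zero expectation in a product of definite-parity block
vectors. [cite: BratteliRobinsonII1997, §5.2.2 eq. (5.2.13)] -/
theorem star_prodFamily_dotProduct_bondPair_conjTranspose_eq_zero (hψ : ∀ R, HasParity (p R) (ψf R))
    {x y : FermionTorus 2 L} (hxy : blockOf hLa hLb x ≠ blockOf hLa hLb y) :
    star ((rectBlockPartition hLa hLb).prodFamily ψf) ⬝ᵥ
      ((bondPair x y)ᴴ *ᵥ (rectBlockPartition hLa hLb).prodFamily ψf) = 0 := by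
  rw [bondPair_conjTranspose, sub_mulVec, dotProduct_sub, orb_eq_emb hLa hLb x 0, orb_eq_emb hLa hLb y 1,
    orb_eq_emb hLa hLb x 1, orb_eq_emb hLa hLb y 0,
    star_prodFamily_dotProduct_creation_creation_eq_zero (rectBlockPartition hLa hLb) hψ hxy.symm,
    star_prodFamily_dotProduct_creation_creation_eq_zero (rectBlockPartition hLa hLb) hψ hxy.symm, sub_zero]

/-- **The expectation of the sourced torus in the product of copies of one even unit cluster vector**
(`L = Kx a = Ky b`, `a, b < L`): `⟨⊗_R ψ, A_L ⊗_R ψ⟩ = Kx Ky ⟨ψ, A_C ψ⟩` — the inter-block hopping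
and the inter-block source bonds have zero expectation, the blocks contribute `⟨ψ, A_C ψ⟩` each.
[cite: Ruelle1969, §3.3] -/
theorem expect_prodFamily_dWaveSourceTorus [NeZero L] (haL : a < L) (hbL : b < L) (U μ h : ℝ)
    {ψ : Fock (Orb (Fin a ×ₗ Fin b))} (hψ : HasParity 0 ψ) (hψ1 : star ψ ⬝ᵥ ψ = 1) :
    star ((rectBlockPartition hLa hLb).prodFamily fun _ => ψ) ⬝ᵥ
        (dWaveSourceTorus L U μ h *ᵥ (rectBlockPartition hLa hLb).prodFamily fun _ => ψ) =
      ((Kx * Ky : ℕ) : ℂ) * (star ψ ⬝ᵥ (dWaveSourceOpenBox a b U μ h *ᵥ ψ)) := by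
  have hpar : ∀ R : Fin Kx ×ₗ Fin Ky, HasParity ((fun _ => 0) R) ((fun _ => ψ) R) := fun _ => hψ
  have hcut := dWaveSourceTorus_sub_sum_jwEmbed_eq hLa hLb haL hbL U μ h
  rw [sub_eq_iff_eq_add'] at hcut
  rw [hcut]
  -- block terms
  have hblock : ∀ R : Fin Kx ×ₗ Fin Ky,
      star ((rectBlockPartition hLa hLb).prodFamily fun _ => ψ) ⬝ᵥ
        (jwEmbed (blockOrbEmb hLa hLb R) (dWaveSourceOpenBox a b U μ h) *ᵥ
          (rectBlockPartition hLa hLb).prodFamily fun _ => ψ) =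
        star ψ ⬝ᵥ (dWaveSourceOpenBox a b U μ h *ᵥ ψ) := fun R =>
    star_prodFamily_dotProduct_jwEmbed_eq (rectBlockPartition hLa hLb)
      (isParityPreserving_dWaveSourceOpenBox a b U μ h) R (fun _ => hψ1)
  -- inter-block hopping
  have hbond : ∀ bd ∈ (Finset.univ.biUnion fun R : Fin Kx ×ₗ Fin Ky =>
      (Finset.univ : Finset (Bond (Fin a ×ₗ Fin b))).map ⟨bondMap (blockSiteEmb hLa hLb R), bondMap_injective _⟩)ᶜ,
      star ((rectBlockPartition hLa hLb).prodFamily fun _ => ψ) ⬝ᵥ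
        (bondOp bd *ᵥ (rectBlockPartition hLa hLb).prodFamily fun _ => ψ) = 0 := fun bd hbd =>
    star_prodFamily_dotProduct_hop_eq_zero hLa hLb hpar (blockOf_ne_of_not_mem_bonds hLa hLb (Finset.mem_compl.1 hbd)) _ _
  -- inter-block source bonds
  have hpair : ∀ z ∈ (Finset.univ.biUnion fun R : Fin Kx ×ₗ Fin Ky =>
      (Finset.univ : Finset ((Fin a ×ₗ Fin b) × (Fin a ×ₗ Fin b))).map
        ⟨Prod.map (blockSiteEmb hLa hLb R) (blockSiteEmb hLa hLb R),
          (blockSiteEmb hLa hLb R).injective.prodMap (blockSiteEmb hLa hLb R).injective⟩)ᶜ,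
      star ((rectBlockPartition hLa hLb).prodFamily fun _ => ψ) ⬝ᵥ
        (bondPair z.1 z.2 *ᵥ (rectBlockPartition hLa hLb).prodFamily fun _ => ψ) = 0 := fun z hz =>
    star_prodFamily_dotProduct_bondPair_eq_zero hLa hLb hpar (blockOf_ne_of_not_mem_pairs hLa hLb (Finset.mem_compl.1 hz))
  have hpair' : ∀ z ∈ (Finset.univ.biUnion fun R : Fin Kx ×ₗ Fin Ky =>
      (Finset.univ : Finset ((Fin a ×ₗ Fin b) × (Fin a ×ₗ Fin b))).map
        ⟨Prod.map (blockSiteEmb hLa hLb R) (blockSiteEmb hLa hLb R),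
          (blockSiteEmb hLa hLb R).injective.prodMap (blockSiteEmb hLa hLb R).injective⟩)ᶜ,
      star ((rectBlockPartition hLa hLb).prodFamily fun _ => ψ) ⬝ᵥ
        ((bondPair z.1 z.2)ᴴ *ᵥ (rectBlockPartition hLa hLb).prodFamily fun _ => ψ) = 0 := fun z hz =>
    star_prodFamily_dotProduct_bondPair_conjTranspose_eq_zero hLa hLb hpar
      (blockOf_ne_of_not_mem_pairs hLa hLb (Finset.mem_compl.1 hz))
  -- the four pieces of `⟨Ψ, A_L Ψ⟩`
  have hB : star ((rectBlockPartition hLa hLb).prodFamily fun _ => ψ) ⬝ᵥ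
      ((∑ R : Fin Kx ×ₗ Fin Ky, jwEmbed (blockOrbEmb hLa hLb R) (dWaveSourceOpenBox a b U μ h)) *ᵥ
        (rectBlockPartition hLa hLb).prodFamily fun _ => ψ) =
      ((Kx * Ky : ℕ) : ℂ) * (star ψ ⬝ᵥ (dWaveSourceOpenBox a b U μ h *ᵥ ψ)) := by
    rw [Matrix.sum_mulVec, dotProduct_sum, Finset.sum_congr rfl fun R _ => hblock R, Finset.sum_const,
      Finset.card_univ, card_blocks, nsmul_eq_mul]
  have hS : star ((rectBlockPartition hLa hLb).prodFamily fun _ => ψ) ⬝ᵥ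
      ((∑ bd ∈ (Finset.univ.biUnion fun R : Fin Kx ×ₗ Fin Ky =>
          (Finset.univ : Finset (Bond (Fin a ×ₗ Fin b))).map ⟨bondMap (blockSiteEmb hLa hLb R), bondMap_injective _⟩)ᶜ,
        hubbardCoupling (fermionTorusGraph 2 L) ((1 : ℝ) : ℂ) bd • bondOp bd) *ᵥ
        (rectBlockPartition hLa hLb).prodFamily fun _ => ψ) = 0 := by
    rw [Matrix.sum_mulVec, dotProduct_sum]
    exact Finset.sum_eq_zero fun bd hbd => by rw [Matrix.smul_mulVec, dotProduct_smul, hbond bd hbd, smul_zero]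
  have hT : star ((rectBlockPartition hLa hLb).prodFamily fun _ => ψ) ⬝ᵥ
      ((∑ z ∈ (Finset.univ.biUnion fun R : Fin Kx ×ₗ Fin Ky =>
          (Finset.univ : Finset ((Fin a ×ₗ Fin b) × (Fin a ×ₗ Fin b))).map
            ⟨Prod.map (blockSiteEmb hLa hLb R) (blockSiteEmb hLa hLb R),
              (blockSiteEmb hLa hLb R).injective.prodMap (blockSiteEmb hLa hLb R).injective⟩)ᶜ,
        dWaveTorusPairWeight L z • bondPair z.1 z.2) *ᵥ (rectBlockPartition hLa hLb).prodFamily fun _ => ψ) = 0 := by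
    rw [Matrix.sum_mulVec, dotProduct_sum]
    exact Finset.sum_eq_zero fun z hz => by rw [Matrix.smul_mulVec, dotProduct_smul, hpair z hz, smul_zero]
  have hT' : star ((rectBlockPartition hLa hLb).prodFamily fun _ => ψ) ⬝ᵥ
      ((∑ z ∈ (Finset.univ.biUnion fun R : Fin Kx ×ₗ Fin Ky =>
          (Finset.univ : Finset ((Fin a ×ₗ Fin b) × (Fin a ×ₗ Fin b))).map
            ⟨Prod.map (blockSiteEmb hLa hLb R) (blockSiteEmb hLa hLb R),
              (blockSiteEmb hLa hLb R).injective.prodMap (blockSiteEmb hLa hLb R).injective⟩)ᶜ,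
        dWaveTorusPairWeight L z • bondPair z.1 z.2)ᴴ *ᵥ (rectBlockPartition hLa hLb).prodFamily fun _ => ψ) = 0 := by
    rw [conjTranspose_sum, Matrix.sum_mulVec, dotProduct_sum]
    exact Finset.sum_eq_zero fun z hz => by
      rw [conjTranspose_smul, Matrix.smul_mulVec, dotProduct_smul, hpair' z hz, smul_zero]
  rw [add_mulVec, dotProduct_add, hB, sub_mulVec, dotProduct_sub, neg_mulVec, dotProduct_neg, hS,
    Matrix.smul_mulVec, dotProduct_smul, add_mulVec, dotProduct_add, hT, hT', add_zero, smul_zero, neg_zero,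
    sub_zero, add_zero]

/-- **Cluster variational principle for the pair-sourced torus.** For `L = Kx a = Ky b` with
`a, b < L` and every EVEN-parity unit vector `ψ` of the open sourced `a × b` cluster,
`E₀(dWaveSourceTorus L U μ h) ≤ Kx Ky · Re⟨ψ, dWaveSourceOpenBox a b U μ h ψ⟩`.
[cite: Ruelle1969, §3.3] -/
theorem groundEnergy_dWaveSourceTorus_le_mul_expect_openBox [NeZero L] (hLa : L = Kx * a) (hLb : L = Ky * b)
    (haL : a < L) (hbL : b < L) (U μ h : ℝ) {ψ : Fock (Orb (Fin a ×ₗ Fin b))} (hψ : HasParity 0 ψ) (hψ1 : star ψ ⬝ᵥ ψ = 1) :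
    (dWaveSourceTorus L U μ h).groundEnergy ≤
      ((Kx * Ky : ℕ) : ℝ) * (star ψ ⬝ᵥ (dWaveSourceOpenBox a b U μ h *ᵥ ψ)).re := by
  have hunit : star ((rectBlockPartition hLa hLb).prodFamily fun _ => ψ) ⬝ᵥ
      ((rectBlockPartition hLa hLb).prodFamily fun _ => ψ) = 1 := by
    rw [(rectBlockPartition hLa hLb).star_prodFamily_dotProduct_prodFamily]
    exact Finset.prod_eq_one fun _ _ => hψ1
  have hH : (dWaveSourceTorus L U μ h).IsHermitian := by
    rw [dWaveSourceTorus_eq_sourcedForm]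
    exact isHermitian_sourced _ 1 U μ h _
  have hle := Matrix.groundEnergy_le_rayleigh_holds hH _ hunit
  rw [expect_prodFamily_dWaveSourceTorus hLa hLb haL hbL U μ h hψ hψ1] at hle
  rw [show ((Kx * Ky : ℕ) : ℂ) = (((Kx * Ky : ℕ) : ℝ) : ℂ) by norm_cast, Complex.re_ofReal_mul] at hle
  exact hle

/-- The same bound per site: `E₀(dWaveSourceTorus L U μ h) ≤ (Re⟨ψ, A_C ψ⟩ / (a b)) · L²`.
[cite: Ruelle1969, §3.3] -/
theorem groundEnergy_dWaveSourceTorus_le_div_mul_sq [NeZero L] {Kx Ky : ℕ} (hLa : L = Kx * a)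
    (hLb : L = Ky * b) (haL : a < L) (hbL : b < L) (U μ h : ℝ) {ψ : Fock (Orb (Fin a ×ₗ Fin b))} (hψ : HasParity 0 ψ) (hψ1 : star ψ ⬝ᵥ ψ = 1) :
    (dWaveSourceTorus L U μ h).groundEnergy ≤
      (star ψ ⬝ᵥ (dWaveSourceOpenBox a b U μ h *ᵥ ψ)).re / ((a : ℝ) * b) * (L : ℝ) ^ 2 := by
  have ha : 0 < a := side_pos_of_eq hLa
  have hb : 0 < b := side_pos_of_eq hLb
  have hle := groundEnergy_dWaveSourceTorus_le_mul_expect_openBox hLa hLb haL hbL U μ h hψ hψ1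
  have hL2 : ((L : ℝ)) ^ 2 = ((Kx * Ky : ℕ) : ℝ) * ((a : ℝ) * b) := by
    rw [sq]
    nth_rewrite 1 [hLa]
    rw [hLb]
    push_cast
    ring
  rw [hL2, div_mul_eq_mul_div, mul_comm ((star ψ ⬝ᵥ _).re), mul_assoc, mul_div_assoc,
    mul_div_cancel_left₀ _ (by positivity : ((a : ℝ) * b) ≠ 0)]
  exact hle

end ProductState

/-! ### The rows: `SourcedTorusEnergyUpperRow` / `SourcedEnergyUpperRow` from a cluster state -/

section Rows

variable {L a b : ℕ}

/-- **The sourced energy CEILING cell of `Rows/SourcedTorusRows` from an even unit cluster vector**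
(`tp = 0`; `L = Kx a = Ky b`, `a, b < L`): `Re⟨ψ, A_C ψ⟩ ≤ e · (a b)` gives
`SourcedTorusEnergyUpperRow L 0 U μ h e`, i.e. `E₀(A_L) ≤ e · L²`. -/
theorem sourcedTorusEnergyUpperRow_of_clusterState [NeZero L] {Kx Ky : ℕ} (hLa : L = Kx * a)
    (hLb : L = Ky * b) (haL : a < L) (hbL : b < L) (U μ h : ℝ) {ψ : Fock (Orb (Fin a ×ₗ Fin b))}
    (hψ : HasParity 0 ψ) (hψ1 : star ψ ⬝ᵥ ψ = 1) {e : ℚ}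
    (he : (star ψ ⬝ᵥ (dWaveSourceOpenBox a b U μ h *ᵥ ψ)).re ≤ ((e : ℚ) : ℝ) * ((a : ℝ) * b)) :
    SourcedTorusEnergyUpperRow L 0 U μ h e := by
  rw [SourcedTorusEnergyUpperRow.iff_dWaveSourceTorus]
  have ha : 0 < a := side_pos_of_eq hLa
  have hb : 0 < b := side_pos_of_eq hLb
  have hab : (0 : ℝ) < (a : ℝ) * b := by positivity
  refine (groundEnergy_dWaveSourceTorus_le_div_mul_sq hLa hLb haL hbL U μ h hψ hψ1).trans ?_
  exact mul_le_mul_of_nonneg_right ((div_le_iff₀ hab).2 he) (by positivity)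

/-- **The uniform sourced energy CEILING row from an even unit cluster vector**: for every side
progression `q` with `a ∣ q`, `b ∣ q` and onset `L₀ > a, b`, `Re⟨ψ, A_C ψ⟩ ≤ e · (a b)` gives
`SourcedEnergyUpperRow 0 U μ h q L₀ e` (`E₀(A_L) ≤ e · L²` for every `L ≥ L₀` with `q ∣ L`; e.g.
`a × b = 4 × 3`, `q = L₀ = 12`). This is the producer-side soundness of the `q`-slot of the row. -/
theorem sourcedEnergyUpperRow_of_clusterState {q L₀ : ℕ} (hqa : a ∣ q) (hqb : b ∣ q) (hLa0 : a < L₀)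
    (hLb0 : b < L₀) (U μ h : ℝ) {ψ : Fock (Orb (Fin a ×ₗ Fin b))} (hψ : HasParity 0 ψ)
    (hψ1 : star ψ ⬝ᵥ ψ = 1) {e : ℚ}
    (he : (star ψ ⬝ᵥ (dWaveSourceOpenBox a b U μ h *ᵥ ψ)).re ≤ ((e : ℚ) : ℝ) * ((a : ℝ) * b)) :
    SourcedEnergyUpperRow 0 U μ h q L₀ e := by
  intro L _ hL hqL
  obtain ⟨Kx, hKx⟩ := hqa.trans hqL
  obtain ⟨Ky, hKy⟩ := hqb.trans hqL
  exact sourcedTorusEnergyUpperRow_of_clusterState (by rw [hKx, mul_comm]) (by rw [hKy, mul_comm])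
    (lt_of_lt_of_le hLa0 hL) (lt_of_lt_of_le hLb0 hL) U μ h hψ hψ1 he

/-- **The uniform row from a cluster CERTIFICATE in existential form** (the shape a certificate node
`∃ ψ even, ‖ψ‖ = 1, Re⟨ψ, A_C ψ⟩ ≤ e·ab` takes — witnessed, e.g., by the normalisation of an integer
vector of the `S^z = 0` sector of the open cluster with an exact-rational Rayleigh quotient `≤ e·ab`). -/
theorem sourcedEnergyUpperRow_of_exists_clusterState {q L₀ : ℕ} (hqa : a ∣ q) (hqb : b ∣ q) (hLa0 : a < L₀)
    (hLb0 : b < L₀) (U μ h : ℝ) {e : ℚ}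
    (hex : ∃ ψ : Fock (Orb (Fin a ×ₗ Fin b)), HasParity 0 ψ ∧ star ψ ⬝ᵥ ψ = 1 ∧
      (star ψ ⬝ᵥ (dWaveSourceOpenBox a b U μ h *ᵥ ψ)).re ≤ ((e : ℚ) : ℝ) * ((a : ℝ) * b)) :
    SourcedEnergyUpperRow 0 U μ h q L₀ e := by
  obtain ⟨ψ, hψ, hψ1, he⟩ := hex
  exact sourcedEnergyUpperRow_of_clusterState hqa hqb hLa0 hLb0 U μ h hψ hψ1 he

end Rows

end Summit.Ventures.CertifiedManyBodySolver

end
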